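/-
Copyright: the b2b-balaban T⁴-continuum CRUX team, row NE7b OWNER lineage `t4-ne7b-p1` (gen 145). Project licence.
-/
import Mathlib

/-!
# THE WEIGHTED OUTPUT LETTERS AT ORDER TWO — THE WEIGHTED CLASS CLOSES FOR `Hk` (SCOPING-d17 (R-c), first file).  (484) proved the
# PLAIN output letters of the step's Hessian majorant `Hk⁺_{vu} = Hk_{vu} + E_D(b^u,b^v)`, `E_D(a,b) = Σ_w(Dᵀa)_w(Dᵀb)_w∕(1−lamA)`,
# `b^v_z = Σ_u|A_{uz}|Hk_{vu}`: `hr⁺ = hr + hr·αr·αc·hc·dr·dc∕(1−lamA)` and `hc⁺`.  The weighted class (SCOPING-d17 (R-b)∕(651)) carries instead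
# the INTRINSIC WEIGHTED letters `Σ_u Hk_{vu}ϑ_{vu} ≤ hrϑ`, `Σ_v Hk_{vu}ϑ_{vu} ≤ hcϑ` against a site weight `ϑ`.  THIS FILE proves that the
# OUTPUT has them too — the closure of the weighted class at order 2 — for abstract weights `ϑ` (site–site), `σ` (site–sampler), `θ`
# (sampler–sampler) with the two compatibilities `ϑ_{xz} ≤ σ_{xw}σ_{zw}` (route through a sampler index) and `σ_{xw} ≤ σ_{xz′}θ_{z′w}` (the
# class's `hσθ`), the admissible `D`'s weighted letters `dθ, dθ′` and the weighted profile letters `αθ` (rows, the class's `haσ`) and `αθc`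
# (columns — the one NEW letter, supplied from `hcϑ` by (651)'s transport):
#   `Σ_u Hk⁺_{vu}ϑ_{vu} ≤ hrϑ + dθ·αθ·dθ′·αθc∕(1−lamA)`,   `Σ_v Hk⁺_{vu}ϑ_{vu} ≤ hcϑ + dθ·αθ·dθ′·αθc∕(1−lamA)`
# — the weighted two-point increment has EXACTLY the shape of the class's `K = αθ·dθ·βθ·dθ′∕(1−lamA)` with the column profile in place of
# `βθ`.  For the exponential weights of one pseudometric at one rate both compatibilities are the triangle inequality ((476) §1) (row NE7b,
# node U5c; Mathlib only; [folklore]).  With (484) `output_second_entry_format` (|HessW(ψ)[e_u,e_v]| ≤ Hk⁺_{vu}) these are the weighted row∕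
# column letters of the OUTPUT Hessian's majorant, uniformly in the background — no support count, no range.

Cell `pub-balaban`, sub-cell `t4`, spine estimate NE7b (`T4WeightBudget.RelWeightBound`; the cell's OWN estimate — NOT PRINTED in
[Bałaban 1983–89], NOT PROVED).  Crux-route work under `Spine/NE7b/` by the row OWNER (`t4-ne7b-p1` gen 145, file (652)) under FREEZE
(0)'s crux-prover clause; NOTHING of Bałaban's is named as a Lean object, valued or asserted; no `T4Continuum/Support` leaf typed; no
`def`, no notation (`E_D`, `b^v` WRITTEN OUT in (484)'s letters); zero `sorry`.  Imports: Mathlib only.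

WHAT IS PROVED ([folklore]): §1 `obs_nonneg`, `transported_profile_row_le` (`Σ_w(Dᵀb^x)_wσ_{xw} ≤ dθ·αθ`), `transported_profile_col_le`
(`Σ_z(Dᵀb^z)_wσ_{zw} ≤ dθ′·αθc`); §2 **`weighted_two_point_increment_row`**, **`weighted_two_point_increment_col`**; §3 THE ENDS
**`output_weighted_rowsum`** (`hrϑ⁺`), **`output_weighted_colsum`** (`hcϑ⁺`); §4 toy.

HONEST (what this is NOT).  Order 2 only; the weighted output letters of `K3⁺, K4⁺, K5⁺` (every term of the entry majorants against star
weights, (R-c) continued), the interpolated entries ((R-a)) and the rate bookkeeping ((R-d): the output weight `ϑ` must be dominated by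
the input's `σ`-rate) are the next files; scalar skeleton ((A3), NC-NE7b-α UNRULED); nothing of Bałaban's asserted.  BY-NAME EFFECT ON THE
WALL: NONE.  NE7b NOT PRINTED ∕ NOT PROVED; spine PROVED 0∕9; rung (B)+1 — the programme's measures remain FINITE-torus statements; NOT the
mass gap, NOT Clay.  HONEST DEPENDENCY: continuum YM on T⁴ ⇐ BetaPertH ∧ nine spine estimates (0∕9 proved); BetaPertH ⇐ (D1) ∧ (D4) ∧
CAP+tail; G-an2-4 gates asym, D1 and NE2∕3∕4.
-/

set_option autoImplicit false

noncomputable section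

namespace Summit.QuantumFields.BalabanUV.T4Continuum.NE7b.SupWeightedSecondOrderLetters

open Finset Real Matrix
open scoped BigOperators

variable {ι κ : Type} [Fintype ι] [Fintype κ]

variable {Hk : ι → ι → ℝ} {A : Matrix ι κ ℝ} {D : κ → κ → ℝ} {ϑ : ι → ι → ℝ} {σ : ι → κ → ℝ} {θ : κ → κ → ℝ}
  {lamA dθ dθ' αθ αθc hrϑ hcϑ : ℝ}

/-! ## §1. The transported profiles against the weights -/

omit [Fintype κ] in
/-- `b^v_z = Σ_u|A_{uz}|Hk_{vu} ≥ 0`. [folklore] -/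
theorem obs_nonneg (hHk0 : ∀ v u, 0 ≤ Hk v u) (v : ι) (z : κ) : 0 ≤ ∑ u, |A u z| * Hk v u :=
  sum_nonneg fun u _ => mul_nonneg (abs_nonneg _) (hHk0 v u)

/-- **Rows**: `Σ_w (Dᵀb^x)_w·σ_{xw} ≤ dθ·αθ` (route `σ_{xw} ≤ σ_{xz′}θ_{z′w}`, then `D`'s weighted row letter and the row profile). [folklore] -/
theorem transported_profile_row_le (hHk0 : ∀ v u, 0 ≤ Hk v u) (hD : ∀ x y, 0 ≤ D x y) (hσ0 : ∀ x w, 0 ≤ σ x w)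
    (hσθ : ∀ x z' w, σ x w ≤ σ x z' * θ z' w) (hDr : ∀ z', ∑ w, D z' w * θ z' w ≤ dθ) (hdθ : 0 ≤ dθ)
    (haσ : ∀ x, ∑ z', (∑ u, |A u z'| * Hk x u) * σ x z' ≤ αθ) (x : ι) :
    ∑ w, (∑ z', D z' w * ∑ u, |A u z'| * Hk x u) * σ x w ≤ dθ * αθ := by
  calc ∑ w, (∑ z', D z' w * ∑ u, |A u z'| * Hk x u) * σ x w
      ≤ ∑ w, ∑ z', D z' w * θ z' w * ((∑ u, |A u z'| * Hk x u) * σ x z') := by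
        refine sum_le_sum fun w _ => ?_
        rw [sum_mul]
        refine sum_le_sum fun z' _ => ?_
        calc D z' w * (∑ u, |A u z'| * Hk x u) * σ x w ≤ D z' w * (∑ u, |A u z'| * Hk x u) * (σ x z' * θ z' w) :=
              mul_le_mul_of_nonneg_left (hσθ x z' w) (mul_nonneg (hD z' w) (obs_nonneg hHk0 x z'))
          _ = D z' w * θ z' w * ((∑ u, |A u z'| * Hk x u) * σ x z') := by ring
    _ = ∑ z', (∑ w, D z' w * θ z' w) * ((∑ u, |A u z'| * Hk x u) * σ x z') := by
        rw [sum_comm]; exact sum_congr rfl fun z' _ => (Finset.sum_mul _ _ _).symm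
    _ ≤ ∑ z', dθ * ((∑ u, |A u z'| * Hk x u) * σ x z') :=
        sum_le_sum fun z' _ => mul_le_mul_of_nonneg_right (hDr z') (mul_nonneg (obs_nonneg hHk0 x z') (hσ0 x z'))
    _ = dθ * ∑ z', (∑ u, |A u z'| * Hk x u) * σ x z' := by rw [mul_sum]
    _ ≤ dθ * αθ := mul_le_mul_of_nonneg_left (haσ x) hdθ

/-- **Columns**: `Σ_z (Dᵀb^z)_w·σ_{zw} ≤ dθ′·αθc` uniformly in `w` (the column profile `Σ_z b^z_{z′}σ_{zz′} ≤ αθc`). [folklore] -/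
theorem transported_profile_col_le (hHk0 : ∀ v u, 0 ≤ Hk v u) (hD : ∀ x y, 0 ≤ D x y) (hθnn : ∀ z w, 0 ≤ θ z w)
    (hσθ : ∀ x z' w, σ x w ≤ σ x z' * θ z' w) (hDc : ∀ w, ∑ z', D z' w * θ z' w ≤ dθ')
    (haσc : ∀ z', ∑ z, (∑ u, |A u z'| * Hk z u) * σ z z' ≤ αθc) (hαθc : 0 ≤ αθc) (w : κ) :
    ∑ z, (∑ z', D z' w * ∑ u, |A u z'| * Hk z u) * σ z w ≤ dθ' * αθc := by
  calc ∑ z, (∑ z', D z' w * ∑ u, |A u z'| * Hk z u) * σ z w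
      ≤ ∑ z, ∑ z', D z' w * θ z' w * ((∑ u, |A u z'| * Hk z u) * σ z z') := by
        refine sum_le_sum fun z _ => ?_
        rw [sum_mul]
        refine sum_le_sum fun z' _ => ?_
        calc D z' w * (∑ u, |A u z'| * Hk z u) * σ z w ≤ D z' w * (∑ u, |A u z'| * Hk z u) * (σ z z' * θ z' w) :=
              mul_le_mul_of_nonneg_left (hσθ z z' w) (mul_nonneg (hD z' w) (obs_nonneg hHk0 z z'))
          _ = D z' w * θ z' w * ((∑ u, |A u z'| * Hk z u) * σ z z') := by ring
    _ = ∑ z', D z' w * θ z' w * ∑ z, (∑ u, |A u z'| * Hk z u) * σ z z' := by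
        rw [sum_comm]; exact sum_congr rfl fun z' _ => by rw [mul_sum]
    _ ≤ ∑ z', D z' w * θ z' w * αθc := sum_le_sum fun z' _ => mul_le_mul_of_nonneg_left (haσc z') (mul_nonneg (hD z' w) (hθnn z' w))
    _ = (∑ z', D z' w * θ z' w) * αθc := by rw [sum_mul]
    _ ≤ dθ' * αθc := mul_le_mul_of_nonneg_right (hDc w) hαθc

/-! ## §2. The weighted two-point increments -/

/-- **THE WEIGHTED TWO-POINT INCREMENT, ROWS**: `Σ_u E_D(b^u,b^v)·ϑ_{vu} ≤ dθ·αθ·(dθ′·αθc)∕(1−lamA)` (route `ϑ_{vu} ≤ σ_{vw}σ_{uw}` through the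
sampler index of `E_D`). [folklore] -/
theorem weighted_two_point_increment_row (hHk0 : ∀ v u, 0 ≤ Hk v u) (hD : ∀ x y, 0 ≤ D x y) (hθnn : ∀ z w, 0 ≤ θ z w) (hσ0 : ∀ x w, 0 ≤ σ x w)
    (hϑσ : ∀ x z w, ϑ x z ≤ σ x w * σ z w) (hσθ : ∀ x z' w, σ x w ≤ σ x z' * θ z' w) (hDr : ∀ z', ∑ w, D z' w * θ z' w ≤ dθ) (hdθ : 0 ≤ dθ)
    (hDc : ∀ w, ∑ z', D z' w * θ z' w ≤ dθ') (hdθ' : 0 ≤ dθ') (haσ : ∀ x, ∑ z', (∑ u, |A u z'| * Hk x u) * σ x z' ≤ αθ)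
    (haσc : ∀ z', ∑ z, (∑ u, |A u z'| * Hk z u) * σ z z' ≤ αθc) (hαθc : 0 ≤ αθc) (hlamA1 : lamA < 1) (v : ι) :
    ∑ u', (∑ w, (∑ z', D z' w * ∑ u, |A u z'| * Hk u' u) * (∑ z', D z' w * ∑ u, |A u z'| * Hk v u) / (1 - lamA)) * ϑ v u' ≤
      dθ * αθ * (dθ' * αθc) / (1 - lamA) := by
  have hl : 0 < 1 - lamA := by linarith
  have hP0 : ∀ (r : ι) (w : κ), 0 ≤ ∑ z', D z' w * ∑ u, |A u z'| * Hk r u := fun r w =>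
    sum_nonneg fun z' _ => mul_nonneg (hD z' w) (obs_nonneg hHk0 r z')
  -- termwise: route the site weight through `w`
  have h1 : ∑ u', (∑ w, (∑ z', D z' w * ∑ u, |A u z'| * Hk u' u) * (∑ z', D z' w * ∑ u, |A u z'| * Hk v u) / (1 - lamA)) * ϑ v u' ≤
      ∑ u', ∑ w, ((∑ z', D z' w * ∑ u, |A u z'| * Hk v u) * σ v w) * (((∑ z', D z' w * ∑ u, |A u z'| * Hk u' u) * σ u' w) / (1 - lamA)) := by
    refine sum_le_sum fun u' _ => ?_
    rw [sum_mul]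
    refine sum_le_sum fun w _ => ?_
    rw [div_mul_eq_mul_div, ← mul_div_assoc]
    refine div_le_div_of_nonneg_right ?_ hl.le
    calc (∑ z', D z' w * ∑ u, |A u z'| * Hk u' u) * (∑ z', D z' w * ∑ u, |A u z'| * Hk v u) * ϑ v u'
        ≤ (∑ z', D z' w * ∑ u, |A u z'| * Hk u' u) * (∑ z', D z' w * ∑ u, |A u z'| * Hk v u) * (σ v w * σ u' w) :=
          mul_le_mul_of_nonneg_left (hϑσ v u' w) (mul_nonneg (hP0 u' w) (hP0 v w))
      _ = (∑ z', D z' w * ∑ u, |A u z'| * Hk v u) * σ v w * ((∑ z', D z' w * ∑ u, |A u z'| * Hk u' u) * σ u' w) := by ring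
  refine h1.trans ?_
  rw [sum_comm]
  calc ∑ w, ∑ u', (∑ z', D z' w * ∑ u, |A u z'| * Hk v u) * σ v w * ((∑ z', D z' w * ∑ u, |A u z'| * Hk u' u) * σ u' w / (1 - lamA))
      = ∑ w, (∑ z', D z' w * ∑ u, |A u z'| * Hk v u) * σ v w * ((∑ u', (∑ z', D z' w * ∑ u, |A u z'| * Hk u' u) * σ u' w) / (1 - lamA)) :=
        sum_congr rfl fun w _ => by rw [← mul_sum, ← sum_div]
    _ ≤ ∑ w, (∑ z', D z' w * ∑ u, |A u z'| * Hk v u) * σ v w * (dθ' * αθc / (1 - lamA)) :=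
        sum_le_sum fun w _ => mul_le_mul_of_nonneg_left
          (div_le_div_of_nonneg_right (transported_profile_col_le hHk0 hD hθnn hσθ hDc haσc hαθc w) hl.le) (mul_nonneg (hP0 v w) (hσ0 v w))
    _ = (∑ w, (∑ z', D z' w * ∑ u, |A u z'| * Hk v u) * σ v w) * (dθ' * αθc / (1 - lamA)) := by rw [sum_mul]
    _ ≤ dθ * αθ * (dθ' * αθc / (1 - lamA)) :=
        mul_le_mul_of_nonneg_right (transported_profile_row_le hHk0 hD hσ0 hσθ hDr hdθ haσ v) (div_nonneg (mul_nonneg hdθ' hαθc) hl.le)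
    _ = dθ * αθ * (dθ' * αθc) / (1 - lamA) := by ring

/-- **THE WEIGHTED TWO-POINT INCREMENT, COLUMNS**: `Σ_v E_D(b^u,b^v)·ϑ_{vu} ≤ dθ·αθ·(dθ′·αθc)∕(1−lamA)`. [folklore] -/
theorem weighted_two_point_increment_col (hHk0 : ∀ v u, 0 ≤ Hk v u) (hD : ∀ x y, 0 ≤ D x y) (hθnn : ∀ z w, 0 ≤ θ z w) (hσ0 : ∀ x w, 0 ≤ σ x w)
    (hϑσ : ∀ x z w, ϑ x z ≤ σ x w * σ z w) (hσθ : ∀ x z' w, σ x w ≤ σ x z' * θ z' w) (hDr : ∀ z', ∑ w, D z' w * θ z' w ≤ dθ) (hdθ : 0 ≤ dθ)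
    (hDc : ∀ w, ∑ z', D z' w * θ z' w ≤ dθ') (hdθ' : 0 ≤ dθ') (haσ : ∀ x, ∑ z', (∑ u, |A u z'| * Hk x u) * σ x z' ≤ αθ)
    (haσc : ∀ z', ∑ z, (∑ u, |A u z'| * Hk z u) * σ z z' ≤ αθc) (hαθc : 0 ≤ αθc) (hlamA1 : lamA < 1) (u' : ι) :
    ∑ v, (∑ w, (∑ z', D z' w * ∑ u, |A u z'| * Hk u' u) * (∑ z', D z' w * ∑ u, |A u z'| * Hk v u) / (1 - lamA)) * ϑ v u' ≤
      dθ * αθ * (dθ' * αθc) / (1 - lamA) := by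
  have hl : 0 < 1 - lamA := by linarith
  have hP0 : ∀ (r : ι) (w : κ), 0 ≤ ∑ z', D z' w * ∑ u, |A u z'| * Hk r u := fun r w =>
    sum_nonneg fun z' _ => mul_nonneg (hD z' w) (obs_nonneg hHk0 r z')
  have h1 : ∑ v, (∑ w, (∑ z', D z' w * ∑ u, |A u z'| * Hk u' u) * (∑ z', D z' w * ∑ u, |A u z'| * Hk v u) / (1 - lamA)) * ϑ v u' ≤
      ∑ v, ∑ w, ((∑ z', D z' w * ∑ u, |A u z'| * Hk u' u) * σ u' w) * (((∑ z', D z' w * ∑ u, |A u z'| * Hk v u) * σ v w) / (1 - lamA)) := by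
    refine sum_le_sum fun v _ => ?_
    rw [sum_mul]
    refine sum_le_sum fun w _ => ?_
    rw [div_mul_eq_mul_div, ← mul_div_assoc]
    refine div_le_div_of_nonneg_right ?_ hl.le
    calc (∑ z', D z' w * ∑ u, |A u z'| * Hk u' u) * (∑ z', D z' w * ∑ u, |A u z'| * Hk v u) * ϑ v u'
        ≤ (∑ z', D z' w * ∑ u, |A u z'| * Hk u' u) * (∑ z', D z' w * ∑ u, |A u z'| * Hk v u) * (σ v w * σ u' w) :=
          mul_le_mul_of_nonneg_left (hϑσ v u' w) (mul_nonneg (hP0 u' w) (hP0 v w))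
      _ = (∑ z', D z' w * ∑ u, |A u z'| * Hk u' u) * σ u' w * ((∑ z', D z' w * ∑ u, |A u z'| * Hk v u) * σ v w) := by ring
  refine h1.trans ?_
  rw [sum_comm]
  calc ∑ w, ∑ v, (∑ z', D z' w * ∑ u, |A u z'| * Hk u' u) * σ u' w * ((∑ z', D z' w * ∑ u, |A u z'| * Hk v u) * σ v w / (1 - lamA))
      = ∑ w, (∑ z', D z' w * ∑ u, |A u z'| * Hk u' u) * σ u' w * ((∑ v, (∑ z', D z' w * ∑ u, |A u z'| * Hk v u) * σ v w) / (1 - lamA)) :=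
        sum_congr rfl fun w _ => by rw [← mul_sum, ← sum_div]
    _ ≤ ∑ w, (∑ z', D z' w * ∑ u, |A u z'| * Hk u' u) * σ u' w * (dθ' * αθc / (1 - lamA)) :=
        sum_le_sum fun w _ => mul_le_mul_of_nonneg_left
          (div_le_div_of_nonneg_right (transported_profile_col_le hHk0 hD hθnn hσθ hDc haσc hαθc w) hl.le) (mul_nonneg (hP0 u' w) (hσ0 u' w))
    _ = (∑ w, (∑ z', D z' w * ∑ u, |A u z'| * Hk u' u) * σ u' w) * (dθ' * αθc / (1 - lamA)) := by rw [sum_mul]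
    _ ≤ dθ * αθ * (dθ' * αθc / (1 - lamA)) :=
        mul_le_mul_of_nonneg_right (transported_profile_row_le hHk0 hD hσ0 hσθ hDr hdθ haσ u') (div_nonneg (mul_nonneg hdθ' hαθc) hl.le)
    _ = dθ * αθ * (dθ' * αθc) / (1 - lamA) := by ring

/-! ## §3. THE ENDS: the weighted output letters `hrϑ⁺`, `hcϑ⁺` -/

/-- **THE END — `hrϑ⁺`**: `Σ_u Hk⁺_{vu}ϑ_{vu} = Σ_u (Hk_{vu} + E_D(b^u,b^v))ϑ_{vu} ≤ hrϑ + dθ·αθ·(dθ′·αθc)∕(1−lamA)`. [folklore] -/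
theorem output_weighted_rowsum (hHk0 : ∀ v u, 0 ≤ Hk v u) (hD : ∀ x y, 0 ≤ D x y) (hθnn : ∀ z w, 0 ≤ θ z w) (hσ0 : ∀ x w, 0 ≤ σ x w)
    (hϑσ : ∀ x z w, ϑ x z ≤ σ x w * σ z w) (hσθ : ∀ x z' w, σ x w ≤ σ x z' * θ z' w) (hDr : ∀ z', ∑ w, D z' w * θ z' w ≤ dθ) (hdθ : 0 ≤ dθ)
    (hDc : ∀ w, ∑ z', D z' w * θ z' w ≤ dθ') (hdθ' : 0 ≤ dθ') (haσ : ∀ x, ∑ z', (∑ u, |A u z'| * Hk x u) * σ x z' ≤ αθ)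
    (haσc : ∀ z', ∑ z, (∑ u, |A u z'| * Hk z u) * σ z z' ≤ αθc) (hαθc : 0 ≤ αθc) (hlamA1 : lamA < 1)
    (hHkϑ : ∀ v, ∑ u, Hk v u * ϑ v u ≤ hrϑ) (v : ι) :
    ∑ u', (Hk v u' + ∑ w, (∑ z', D z' w * ∑ u, |A u z'| * Hk u' u) * (∑ z', D z' w * ∑ u, |A u z'| * Hk v u) / (1 - lamA)) * ϑ v u' ≤
      hrϑ + dθ * αθ * (dθ' * αθc) / (1 - lamA) := by
  simp only [add_mul, sum_add_distrib]
  exact add_le_add (hHkϑ v) (weighted_two_point_increment_row hHk0 hD hθnn hσ0 hϑσ hσθ hDr hdθ hDc hdθ' haσ haσc hαθc hlamA1 v)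

/-- **THE END — `hcϑ⁺`**: `Σ_v Hk⁺_{vu}ϑ_{vu} ≤ hcϑ + dθ·αθ·(dθ′·αθc)∕(1−lamA)`. [folklore] -/
theorem output_weighted_colsum (hHk0 : ∀ v u, 0 ≤ Hk v u) (hD : ∀ x y, 0 ≤ D x y) (hθnn : ∀ z w, 0 ≤ θ z w) (hσ0 : ∀ x w, 0 ≤ σ x w)
    (hϑσ : ∀ x z w, ϑ x z ≤ σ x w * σ z w) (hσθ : ∀ x z' w, σ x w ≤ σ x z' * θ z' w) (hDr : ∀ z', ∑ w, D z' w * θ z' w ≤ dθ) (hdθ : 0 ≤ dθ)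
    (hDc : ∀ w, ∑ z', D z' w * θ z' w ≤ dθ') (hdθ' : 0 ≤ dθ') (haσ : ∀ x, ∑ z', (∑ u, |A u z'| * Hk x u) * σ x z' ≤ αθ)
    (haσc : ∀ z', ∑ z, (∑ u, |A u z'| * Hk z u) * σ z z' ≤ αθc) (hαθc : 0 ≤ αθc) (hlamA1 : lamA < 1)
    (hHkϑc : ∀ u', ∑ v, Hk v u' * ϑ v u' ≤ hcϑ) (u' : ι) :
    ∑ v, (Hk v u' + ∑ w, (∑ z', D z' w * ∑ u, |A u z'| * Hk u' u) * (∑ z', D z' w * ∑ u, |A u z'| * Hk v u) / (1 - lamA)) * ϑ v u' ≤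
      hcϑ + dθ * αθ * (dθ' * αθc) / (1 - lamA) := by
  simp only [add_mul, sum_add_distrib]
  exact add_le_add (hHkϑc u') (weighted_two_point_increment_col hHk0 hD hθnn hσ0 hϑσ hσθ hDr hdθ hDc hdθ' haσ haσc hαθc hlamA1 u')

/-! ## §4. Toy -/

/-- Toy (the compatibilities for exponential weights are the triangle inequality): `e^{d(x,z)} ≤ e^{d(x,w)}·e^{d(z,w)}` for a pseudometric. -/
example {X : Type} [PseudoMetricSpace X] (x z w : X) : Real.exp (dist x z) ≤ Real.exp (dist x w) * Real.exp (dist z w) := by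
  rw [← Real.exp_add, Real.exp_le_exp, dist_comm z w]
  exact dist_triangle x w z

end Summit.QuantumFields.BalabanUV.T4Continuum.NE7b.SupWeightedSecondOrderLetters

end
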